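import Literature.NumberTheory.GaloisRepresentations.ContinuousCohomologyBocksteinFunctorial
import Literature.AnabelianGeometry.AbsoluteAnabelian.FreeProcyclicStructure
import HarnessLib

/-!
# Open subgroups of a free procyclic group are free procyclic (generated by `γⁿ`), and
# restriction to the subgroup of index `n` multiplies the invariant `H²(·, ℤ) ⥲ ℚ/ℤ` by `n`

abc-iut cell, layer L4.  PROOF file (no definition, no named fact).  For a profinite group `G` with a
dense cyclic subgroup `γ^ℤ` and an open subgroup of every positive index — the cell's
`FundamentalExtension.IsFreeProcyclic G`, "`G ≅ Ẑ`" ([AbsTopI] §0 p. 7 "the profinite completion of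
`ℤ`", whose open subgroups `nẐ ≅ Ẑ` are the objects below) — and an open subgroup `H` of index `n`
(which is `closure ⟨γⁿ⟩`, the tree's `eq_closureZpowersPow_of_isOpen_of_index`,
`FreeProcyclicStructure.lean`):

* `dense_zpowers_pow_subgroupOf` — `⟨γⁿ⟩` is dense in `H` (subspace topology);
* `exists_isOpen_index_subgroupOf` — `H` has an open subgroup of every positive index `m` (the
  subgroup of `G` of index `n m`);
* `FundamentalExtension.IsFreeProcyclic.of_isOpen` — **an open subgroup of a free procyclic profinite
  group is free procyclic** ("`nẐ ≅ Ẑ`");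
* `H2IntEquivQModZ_resSubgroup` — **`inv_{H,γⁿ}(res c) = n • inv_{G,γ}(c)`** for every
  `c ∈ H²(G, ℤ)`: restriction to the open subgroup of index `n` multiplies the invariant
  `H²(·, ℤ) ⥲ ℚ/ℤ` (trunk `H2IntEquivQModZ`, through the inverse Bockstein and evaluation at the
  generator) by the index — the case "`θ` = inclusion, `θ(γⁿ) = γⁿ`" of the trunk's index formula
  `H2IntEquivQModZ_pullH_of_pow_eq` (Serre, *Local Fields* XIII §3 Prop. 7 for an unramified
  extension of degree `n`: `inv_E ∘ res = n · inv_F`; [AbsTopIII] Rmk. 1.10.1 (iii) / Rmk. 3.2.2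
  «dividing by the index of the image of the induced open homomorphism»).

HONEST FRAMING: classical; nothing here bears on [IUTchIII] Cor. 3.12 or takes a side.
-/

noncomputable section

open CategoryTheory Function

universe u

namespace Literature.AnabelianGeometry.AbsoluteAnabelian

open Literature.NumberTheory.GaloisRepresentations
open _root_.TopRep _root_.ContRepresentation _root_.ContinuousCohomology _root_.Topology

variable {G : Type u} [Group G] [TopologicalSpace G] [IsTopologicalGroup G]

/-- `closure ⟨γ^(n m)⟩ ≤ closure ⟨γⁿ⟩`. [cite: MochizukiAbsTopI2012, §0 p.7] -/
theorem topologicalClosure_zpowers_pow_mul_le (γ : G) (n m : ℕ) :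
    (Subgroup.zpowers (γ ^ (n * m))).topologicalClosure ≤
      (Subgroup.zpowers (γ ^ n)).topologicalClosure :=
  Subgroup.topologicalClosure_mono
    ((Subgroup.zpowers_le).mpr (by rw [pow_mul]; exact Subgroup.pow_mem _ (Subgroup.mem_zpowers _) m))

variable [T2Space G]

/-- For an open subgroup `H` of index `n ≥ 1` in a Hausdorff group with dense `⟨γ⟩`, `γⁿ ∈ H`.
[cite: MochizukiAbsTopI2012, §0 p.7] -/
theorem pow_index_mem_of_dense_zpowers {γ : G} (hγ : Dense (Subgroup.zpowers γ : Set G))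
    {H : Subgroup G} (hH : IsOpen (H : Set G)) {n : ℕ} (hn : 0 < n) (hidx : H.index = n) :
    γ ^ n ∈ H := by
  rw [eq_closureZpowersPow_of_isOpen_of_index hγ hH hn hidx]
  exact Subgroup.le_topologicalClosure _ (Subgroup.mem_zpowers _)

/-- **`⟨γⁿ⟩` is dense in the open subgroup `H` of index `n`** (subspace topology), for `G` Hausdorff with
dense `⟨γ⟩`: `H = closure ⟨γⁿ⟩`. [cite: MochizukiAbsTopI2012, §0 p.7] -/
theorem dense_zpowers_pow_subgroupOf {γ : G} (hγ : Dense (Subgroup.zpowers γ : Set G))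
    {H : Subgroup G} (hH : IsOpen (H : Set G)) {n : ℕ} (hn : 0 < n) (hidx : H.index = n) :
    Dense (Subgroup.zpowers (⟨γ ^ n, pow_index_mem_of_dense_zpowers hγ hH hn hidx⟩ : H) : Set H) := by
  have hHeq := eq_closureZpowersPow_of_isOpen_of_index hγ hH hn hidx
  rw [Subtype.dense_iff]
  intro x hx
  have hx' : x ∈ closure ((Subgroup.zpowers (γ ^ n) : Set G)) := by
    rw [← Subgroup.topologicalClosure_coe, ← hHeq]; exact hx
  refine closure_mono (fun y hy => ?_) hx'
  obtain ⟨k, rfl⟩ := Subgroup.mem_zpowers_iff.mp hy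
  exact ⟨(⟨γ ^ n, pow_index_mem_of_dense_zpowers hγ hH hn hidx⟩ : H) ^ k,
    Subgroup.mem_zpowers_iff.mpr ⟨k, rfl⟩, by simp⟩

/-- **The open subgroup `H` of index `n` of `G` has an open subgroup of every positive index `m`**:
the subgroup of `G` of index `n m` (it lies in `H` as `closure ⟨γ^(nm)⟩ ≤ closure ⟨γⁿ⟩ = H`).
[cite: MochizukiAbsTopI2012, §0 p.7] -/
theorem exists_isOpen_index_subgroupOf {γ : G} (hγ : Dense (Subgroup.zpowers γ : Set G))
    (hidxG : ∀ n : ℕ, 0 < n → ∃ K : Subgroup G, IsOpen (K : Set G) ∧ K.index = n)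
    {H : Subgroup G} (hH : IsOpen (H : Set G)) {n : ℕ} (hn : 0 < n) (hidx : H.index = n)
    (m : ℕ) (hm : 0 < m) :
    ∃ K : Subgroup H, IsOpen (K : Set H) ∧ K.index = m := by
  obtain ⟨K, hKo, hKi⟩ := hidxG (n * m) (Nat.mul_pos hn hm)
  have hKH : K ≤ H := by
    rw [eq_closureZpowersPow_of_isOpen_of_index hγ hKo (Nat.mul_pos hn hm) hKi,
      eq_closureZpowersPow_of_isOpen_of_index hγ hH hn hidx]
    exact topologicalClosure_zpowers_pow_mul_le γ n m
  refine ⟨K.subgroupOf H, ?_, ?_⟩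
  · exact hKo.preimage continuous_subtype_val
  · have h := Subgroup.relIndex_mul_index hKH
    rw [hidx, hKi, mul_comm n m] at h
    exact Nat.eq_of_mul_eq_mul_right hn h

variable [CompactSpace G]

/-- **An open subgroup of a free procyclic profinite group is free procyclic** ("`nẐ ≅ Ẑ`"),
topologically generated by `γⁿ` for any topological generator `γ` of `G`, `n` the index.
[cite: MochizukiAbsTopI2012, §0 p.7] -/
theorem FundamentalExtension.IsFreeProcyclic.of_isOpen (h : FundamentalExtension.IsFreeProcyclic G)
    {H : Subgroup G} (hH : IsOpen (H : Set G)) : FundamentalExtension.IsFreeProcyclic H := by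
  obtain ⟨γ, hγ⟩ := h.exists_dense_zpowers
  haveI : Finite (G ⧸ H) := Subgroup.quotient_finite_of_isOpen H hH
  have hn : 0 < H.index := Nat.pos_of_ne_zero H.index_ne_zero_of_finite
  exact ⟨⟨_, dense_zpowers_pow_subgroupOf hγ hH hn rfl⟩,
    exists_isOpen_index_subgroupOf hγ h.exists_isOpen_index hH hn rfl⟩

variable [TotallyDisconnectedSpace G]

/-- **Restriction to the open subgroup of index `n` multiplies the invariant by `n`**:
for `G ≅ Ẑ` topologically generated by `γ`, `H ≤ G` open of index `n` (generated by `γⁿ`) and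
`c ∈ H²(G, ℤ)`, `inv_{H,γⁿ}(res c) = n • inv_{G,γ}(c)` in `ℚ/ℤ` — the group-cohomological content of
"`inv_E ∘ res_{E/F} = [E:F] · inv_F`" for the unramified extension of degree `n`.
[cite: SerreLocalFields1979, XIII §3 Prop. 7] -/
theorem H2IntEquivQModZ_resSubgroup {γ : G} (hγ : Dense (Subgroup.zpowers γ : Set G))
    (hidxG : ∀ n : ℕ, 0 < n → ∃ K : Subgroup G, IsOpen (K : Set G) ∧ K.index = n)
    {H : Subgroup G} (hH : IsOpen (H : Set G)) {n : ℕ} (hn : 0 < n) (hidx : H.index = n)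
    (c : continuousCohomology 2 (ContinuousRep.trivial G ℤ ZCoeff.{u}).toTopRep) :
    haveI : IsClosed (H : Set G) := Subgroup.isClosed_of_isOpen H hH
    haveI : CompactSpace H := isCompact_iff_compactSpace.mp (Subgroup.isClosed_of_isOpen H hH).isCompact
    H2IntEquivQModZ (dense_zpowers_pow_subgroupOf hγ hH hn hidx)
        (exists_isOpen_index_subgroupOf hγ hidxG hH hn hidx)
        (pullH (subgroupIncl H) (ContinuousRep.trivial G ℤ ZCoeff.{u}) 2 c) =
      n • H2IntEquivQModZ hγ hidxG c := by
  haveI : CompactSpace H := isCompact_iff_compactSpace.mp (Subgroup.isClosed_of_isOpen H hH).isCompact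
  exact H2IntEquivQModZ_pullH_of_pow_eq (subgroupIncl H) (γ := γ)
    (γ' := (⟨γ ^ n, pow_index_mem_of_dense_zpowers hγ hH hn hidx⟩ : H)) (m := n) rfl hγ hidxG
    (dense_zpowers_pow_subgroupOf hγ hH hn hidx) (exists_isOpen_index_subgroupOf hγ hidxG hH hn hidx) c

end Literature.AnabelianGeometry.AbsoluteAnabelian

end
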